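import Mathlib
import Literature.Analysis.FluidPDE.ClassicalSolution

/-!
# Navier–Stokes on `ℝ³`: uniqueness of smooth finite-energy solutions from smooth `H¹` data

Named literature fact (D-0014: a `def … : Prop`, no proof) from

* Tao, *Localisation and compactness properties of the Navier–Stokes global regularity problem*,
  Anal. PDE 6 (2013) 25–107 = arXiv:1108.1165 [cite: Tao2011].

Setting of the paper (Def. 1.1 p2, p3, p8): a *smooth finite energy solution* on `[0,T] × ℝ³` is a
pair `(u,p)` jointly smooth on `[0,T] × ℝ³` solving `∂ₜu + (u·∇)u = Δu − ∇p`, `∇·u = 0`,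
`u(0) = u₀`, with `‖u‖_{L^∞_t L²_x([0,T]×ℝ³)} < ∞` (eq. (6)); **no** dissipation bound
`∇u ∈ L²_t L²_x`, no decay of `u` or `∇u` at spatial infinity and no condition on `p` are assumed
(footnote 2 p3: the dissipation bound is automatic, Lemma 8.1). The datum is *smooth H¹* if
`u₀` is smooth, divergence-free and `‖u₀‖_{H¹} < ∞` (p2).

Corollary 11.4 (Unconditional uniqueness, p69): for smooth `H¹` data there is at most one almost
smooth finite energy solution with normalised pressure. Its proof (Remark 11.3 p69) is the chain
Lemma 8.1 + Corollary 11.1 (p68: such a solution is an `H¹` solution) + Corollary 4.3 (p28: for an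
almost smooth `H¹` solution `(u,p)` — no hypothesis on `p` — the pair `(u, p̃)` with the Riesz
pressure `p̃ = −Δ⁻¹∂ᵢ∂ⱼ(uᵢuⱼ)` is a mild `H¹` solution) + Theorem 5.4(iii) (p33: mild `H¹`
solutions are unique). Read on **velocities**, the chain gives: two smooth finite energy
solutions on `[0,T] × ℝ³` from the same smooth `H¹` datum have the same velocity field (the
printed clause "with normalised pressure" only removes the pressure-shift symmetry (32),
`p ↦ p + C(t)`, which does not move `u`). We vendor this velocity form, which needs no
Riesz-pressure notion. Tao writes `ν = 1`; general `ν > 0` follows by `v(s,y) = ν⁻¹ u(s/ν, y)`.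

Tree shape: "jointly smooth on `[0,T] × ℝ³` + NS + div-free" is
`Literature.Fluid.IsClassicalNSSolutionOn (Icc 0 T) ν 0 u p` (`ClassicalSolution.lean`; one-sided time
derivatives at the endpoints), which is Tao's *smooth* (a fortiori almost smooth) solution; the
finite-energy hypothesis (6) is the `lintegral` bound below (for smooth `u`, `t ↦ ‖u t‖₂` is lower
semicontinuous, so `sup = ess sup`); the `H¹` datum is `∫|u₀|² < ∞ ∧ ∫‖∇u₀‖² < ∞` with `∇u₀` the
Fréchet derivative (operator norm; equivalent to the Frobenius norm up to a dimensional constant).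

Consumer: X5b of routes `NavierStokesRegularity/Blowup`, `/CertifiedBlowup`
(uniqueness in Fefferman's class (A) against the classical Leray–Hopf solution), applied on closed
sub-slabs `[0,T′]`, `T′ < T`.
-/

namespace Literature.Analysis.FluidPDE

open MeasureTheory Set
open scoped ENNReal

/-- **Tao 2013, Corollary 11.4 (Unconditional uniqueness), velocity form** (proof chain of
Remark 11.3: Lemma 8.1, Cor. 11.1, Cor. 4.3, Thm. 5.4(iii)). Let `ν > 0`, `0 < T < ∞`, and let
`u₀ : ℝ³ → ℝ³` be a smooth `H¹` datum (`∫|u₀|² < ∞`, `∫‖∇u₀‖² < ∞`). If `(u,p)` and `(v,q)` are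
smooth solutions of Navier–Stokes on `[0,T] × ℝ³` (jointly `C^∞`, unforced) with
`u(0) = v(0) = u₀` and finite energy `sup_{t ∈ [0,T]} ∫|u(t)|² < ∞`, `sup_{t ∈ [0,T]} ∫|v(t)|² < ∞`
— and no further decay, dissipation or pressure hypothesis — then `u(t) = v(t)` for all
`t ∈ [0,T]`. (Printed for `ν = 1`; general `ν` by scaling.) [cite: Tao2011, Cor. 11.4] -/
def tao_finite_energy_velocity_uniqueness : Prop :=
  ∀ (ν T : ℝ), 0 < ν → 0 < T →
  ∀ (u₀ : EuclideanSpace ℝ (Fin 3) → EuclideanSpace ℝ (Fin 3)),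
    (∫⁻ x, ‖u₀ x‖ₑ ^ 2) < ⊤ →
    (∫⁻ x, ‖fderiv ℝ u₀ x‖ₑ ^ 2) < ⊤ →
  ∀ (u v : ℝ → EuclideanSpace ℝ (Fin 3) → EuclideanSpace ℝ (Fin 3))
    (p q : ℝ → EuclideanSpace ℝ (Fin 3) → ℝ),
    Literature.Analysis.FluidPDE.IsClassicalNSSolutionOn (Icc 0 T) ν 0 u p →
    Literature.Analysis.FluidPDE.IsClassicalNSSolutionOn (Icc 0 T) ν 0 v q →
    u 0 = u₀ → v 0 = u₀ →
    (∃ C : ℝ≥0∞, C < ⊤ ∧ ∀ t ∈ Icc 0 T, (∫⁻ x, ‖u t x‖ₑ ^ 2) ≤ C) →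
    (∃ C : ℝ≥0∞, C < ⊤ ∧ ∀ t ∈ Icc 0 T, (∫⁻ x, ‖v t x‖ₑ ^ 2) ≤ C) →
    ∀ t ∈ Icc 0 T, u t = v t

end Literature.Analysis.FluidPDE
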